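import Summits.HodgeConjecture.HodgeConjecture.Theses.GenericDivisibility
import Literature.AlgebraicGeometry.Motives.UnramifiedCohomology
import Literature.AlgebraicTopology.SingularHomology.IntegralClassRingChange
import HarnessLib

/-!
# Route GenericDivisibility — crux `HodgeClassesGenericallyDivisible` (stmt-HodgeConjecture-18466), line `Sketch`: stub `stub_multipleSupportedComplexSupported`

Registered stub 5 of the lead's skeleton `Cruxes/HodgeClassesGenericallyDivisible/Lines/Sketch.lean`
(diagnostic lemma (O-L2) of the card `ordinary-inertia-rigidity`): if a multiple `N • z`
(`N ≥ 1`) of an integral class `z ∈ H^q(X(ℂ); ℤ)` has INTEGRAL coniveau `≥ 1`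
(`N • z ∈ coniveauFiltration ℤ X q 1`, i.e. `N • z` dies on the complex points of the complement of
a Zariski-closed subset all of whose points have codimension `≥ 1`), then the complexification
`z ⊗ 1 ∈ H^q(X(ℂ); ℂ)` lies in `N¹ H^q(X(ℂ); ℂ) = supportedClasses X q 1`.

Proof: `coniveauFiltration ℂ X q 1` is `supportedClasses X q 1` on the nose
(`coniveauFiltration_complex`); change of coefficients commutes with restriction
(`singularCohomology.ringChange_map`), so `N • (z ⊗ 1)|_{(X∖Z)(ℂ)} = ((N • z)|_{(X∖Z)(ℂ)}) ⊗ 1 = 0`,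
and `N` is invertible in the `ℂ`-vector space `H^q((X∖Z)(ℂ); ℂ)`. No hypothesis on `X` is needed.
References: Grothendieck, *Hodge's general conjecture is false for trivial reasons* (1969) §1;
Bloch–Ogus (1974) (3.8).
-/

noncomputable section

-- every declaration of this problem lives in `Summit.HodgeConjecture.HodgeConjecture.…` (summit = sub-problem)
set_option linter.dupNamespace false

open CategoryTheory AlgebraicGeometry
open Literature.AlgebraicGeometry.Motives Literature.AlgebraicGeometry.HodgeTheory
  Literature.AlgebraicTopology.SingularHomology

namespace Summit.HodgeConjecture.HodgeConjecture.Theorems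

/-- Change of coefficients `ℤ → ℂ` commutes with restriction to the complex points over the
complement of `Z ⊆ X`: `(z ⊗ 1)|_{(X∖Z)(ℂ)} = (z|_{(X∖Z)(ℂ)}) ⊗ 1`. [cite: HatcherAT2002, §3.1 p. 198] -/
theorem genericDivisibility_restrictToCompl_ringChange_complex {X : SchemeOver ℂ} (q : ℕ)
    (Z : Set X.left) (z : singularCohomology ℤ ℤ (ComplexPoints X) q) :
    restrictToCompl ℂ X q Z (singularCohomology.ringChange (Int.castRingHom ℂ) (ComplexPoints X) q z) =
      singularCohomology.ringChange (Int.castRingHom ℂ) (complexPointsCompl X Z) q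
        (restrictToCompl ℤ X q Z z) := by
  change singularCohomology.map ℂ ℂ _ q _ =
    singularCohomology.ringChange _ _ q (singularCohomology.map ℤ ℤ _ q z)
  rw [singularCohomology.ringChange_map]

/-- **Stub 5 of line `Sketch` (crux C1): a multiple of integral coniveau `≥ 1` forces complex
coniveau `≥ 1`.** If `N • z ∈ N¹ H^q(X(ℂ); ℤ)` for some `N ≥ 1`, then
`z ⊗ 1 ∈ N¹ H^q(X(ℂ); ℂ) = supportedClasses X q 1`: both filtrations are generated by the kernels of
the restrictions to `(X ∖ Z)(ℂ)`, `Z` closed of codimension `≥ 1`; restriction commutes with `⊗ ℂ`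
and `N` is a unit of `ℂ`. [cite: GrothendieckTopology1969, §1] [cite: BlochOgus1974ENS, (3.8)] -/
theorem stub_multipleSupportedComplexSupported : ∀ ⦃X : SchemeOver ℂ⦄ (q : ℕ)
    (z : singularCohomology ℤ ℤ (ComplexPoints X) q) (N : ℕ), 1 ≤ N →
      N • z ∈ coniveauFiltration ℤ X q 1 →
      singularCohomology.ringChange (Int.castRingHom ℂ) (ComplexPoints X) q z ∈
        supportedClasses X q 1 := by
  intro X q z N hN hz
  obtain ⟨Z, hZ, hr, h0⟩ := (mem_coniveauFiltration_iff_exists ℤ q).1 hz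
  rw [← coniveauFiltration_complex]
  refine mem_coniveauFiltration_of_restrictToCompl_eq_zero ℂ q hZ hr ?_
  -- `N • (z ⊗ 1)| = ((N • z)|) ⊗ 1 = 0`
  have h1 : (N : ℂ) • restrictToCompl ℂ X q Z
      (singularCohomology.ringChange (Int.castRingHom ℂ) (ComplexPoints X) q z) = 0 := by
    rw [Nat.cast_smul_eq_nsmul, ← map_nsmul, ← map_nsmul,
      genericDivisibility_restrictToCompl_ringChange_complex, h0, map_zero]
  have hN0 : (N : ℂ) ≠ 0 := Nat.cast_ne_zero.2 (by omega)
  exact (smul_eq_zero.1 h1).resolve_left hN0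

end Summit.HodgeConjecture.HodgeConjecture.Theorems

end
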